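import Literature.NumberTheory.EllipticCurves.PSLineHeight
import Literature.NumberTheory.EllipticCurves.MordellWeil
import Literature.Barriers.BirchSwinnertonDyer.PAdicHeightNondegeneracyProofs
import HarnessLib

/-!
# Route `CyclotomicUntwist`, crux K1 `PSRankOneLowerHalfAtThree` (stmt-BirchSwinnertonDyer-21580):
# RANK-ONE RIGIDITY of line-height data — a D2 datum on a rank-one `E(ℚ)` is determined by ONE value
# per line (indeed per `Aut(R/ℚ₃)`-orbit of lines), and every `ℚ₃`-value occurs

Cell `pub/bsd-wall` (D-0145 line `route-BirchSwinnertonDyer-CyclotomicUntwist`), seat `bsd-line-cycu-p4`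
g0 (width seat). THEOREMS ONLY (no definition, no named fact, no `sorry`); helper `--supports` K1 =
stmt-BirchSwinnertonDyer-21580. BSD is not proved by this file and nothing here is evidence for or
against BSD. Context: the CU pen WITHDREW the item split of K1 (2026-08-28T00:48Z) and filed the
definition item D5 `defn-PSCanonicalSelmerHeight` — canonicity predicates for the D2/D3 hypothesis
structures WITH UNIQUENESS lemmas (`isCanonicalFor_unique`). This file supplies the structural half of
that uniqueness in the tree's present vocabulary, so that D5 only has to pin ONE number:

* §1 (`R`-valued rank-one vanishing / agreement). A biadditive `B : A × A → R` (`R` any `ℚ₃`-algebra)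
  on an abelian group `A` of `ℤ`-rank one that vanishes at `(g, g)` for ONE non-torsion `g` vanishes
  identically; two such forms agreeing at `(g, g)` are equal (the tree's `ℚ_p`-valued
  `pairing_eq_zero_of_finrank_eq_one`, Barriers/PAdicHeightNondegeneracyProofs, verbatim over `R`).
* §2 (rigidity of D2 data). On a curve with `rank_ℤ E(ℚ) = 1`, two line-height data
  `Dh, Dh' : W.PSLineHeightData R` that agree at `(g, g)` on every line (`χ³ = 1`, `χ ≠ 1`) are EQUAL
  (`eq_of_rank_one_of_forall_isLine`); agreement transports along coefficient automorphisms
  (`h_{σχ}(g,g) = σ h_χ(g,g)`), so if every line is `Aut(R/ℚ₃)`-conjugate to `ψ` (the intended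
  `R = ℚ₃(ζ₃)`: the two lines `ψ, ψ̄ = σ∘ψ`), agreement at `(g, g)` on `ψ` ALONE forces `Dh = Dh'`
  (`eq_of_rank_one_of_line_orbit`), i.e. `Dh ↦ h_ψ(g,g)` is injective (`pairing_self_injective_of_line_orbit`).
* (Every `ℚ₃`-value occurs — landed elsewhere: `CyclotomicUntwistLineHeightJunkDatum.exists_lineHeightDatum_pairing_eq_one`
  gives a datum with `h_χ(g,g) = 1` on all lines for any non-torsion `g`, and
  `CyclotomicUntwistSplitVacuity.exists_smul_datum` rescales it by any `c ∈ ℚ₃`; so the structure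
  constrains NOTHING about the one number of §2, which is therefore exactly what D5 must pin — by a
  formula (Nekovář/Benois `h^{spl}`, the `σ`-function height of the `ψ`-splitting), not by a property
  shared by all data. This file is kept route-independent and does not import those two modules.)
* §3 (against the separated closer's `Can` slot, cycu-p3 `psRankOne_halves_of_separated`): if a
  canonicity predicate `Can` admits two data with different `h_ψ(P,P)`, the closer's ∀-GZ₃ hypothesis
  forces `κ_an · q = 0`; if `Can` pins that value, it has at most one datum on a rank-one curve.

Consumer: D5's uniqueness lemma reduces, on the route's rows (rank one by the PUB item), to
«`IsCanonicalFor` determines `h_ψ(g,g)` for one non-torsion `g`». [cite: Benois2020, §0.3 (Thm. I–III)]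
[cite: Schneider1982PadicHeightI, §1] [cite: SilvermanAEC2009, Thm. VIII.6.7]
-/

set_option autoImplicit false
-- single-conjunct summit: `Summit.BirchSwinnertonDyer.BirchSwinnertonDyer.…` repeats the name by design
set_option linter.dupNamespace false

noncomputable section

open scoped Classical

open WeierstrassCurve Literature.NumberTheory.EllipticCurves
  Literature.Barriers.BirchSwinnertonDyer

namespace Summit.BirchSwinnertonDyer.BirchSwinnertonDyer.Theorems.CyclotomicUntwistLineHeightRigidity

/-! ### §1 `R`-valued biadditive forms on a rank-one abelian group -/

section General

variable {A : Type*} [AddCommGroup A] {R : Type*} [CommRing R] [Algebra ℚ_[3] R]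

/-- Non-zero integers act injectively on a `ℚ₃`-algebra (`n • x = (n : ℚ₃) • x` and `n` is a unit of
`ℚ₃`). [folklore] -/
theorem eq_zero_of_zsmul_eq_zero {n : ℤ} (hn : n ≠ 0) {x : R} (h : n • x = 0) : x = 0 := by
  have hnQ : (n : ℚ_[3]) ≠ 0 := by exact_mod_cast hn
  have h' : (n : ℚ_[3]) • x = 0 := by rwa [Int.cast_smul_eq_zsmul]
  simpa [smul_smul, inv_mul_cancel₀ hnQ] using congrArg ((n : ℚ_[3])⁻¹ • ·) h'

/-- **Rank-one vanishing, `R`-valued.** A biadditive `B : A →+ A →+ R` on an abelian group of `ℤ`-rank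
one having a non-torsion isotropic element `g` (`B g g = 0`) vanishes identically: with
`b • Q = a • g`, `d • Q' = c • g` (`b, d ≠ 0`) one gets `(d b) • B Q Q' = (c a) • B g g = 0`.
(The tree's `pairing_eq_zero_of_finrank_eq_one` for `ℚ_p`-valued forms, verbatim.) [folklore] -/
theorem biadditive_apply_eq_zero_of_finrank_eq_one (B : A →+ A →+ R) (h : Module.finrank ℤ A = 1)
    {g : A} (hg : ¬ IsOfFinAddOrder g) (hgg : B g g = 0) (Q Q' : A) : B Q Q' = 0 := by
  obtain ⟨a, b, hb, hQ⟩ := exists_zsmul_eq_zsmul_of_finrank_eq_one h hg Q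
  obtain ⟨c, d, hd, hQ'⟩ := exists_zsmul_eq_zsmul_of_finrank_eq_one h hg Q'
  have h1 : B (b • Q) (d • Q') = d • b • B Q Q' := by
    rw [map_zsmul (B (b • Q)), ← AddMonoidHom.flip_apply B (b • Q) Q', map_zsmul,
      AddMonoidHom.flip_apply]
  have h2 : B (a • g) (c • g) = c • a • B g g := by
    rw [map_zsmul (B (a • g)), ← AddMonoidHom.flip_apply B (a • g) g, map_zsmul,
      AddMonoidHom.flip_apply]
  have key : (d * b) • B Q Q' = 0 := by
    rw [mul_smul, ← h1, hQ, hQ', h2, hgg, smul_zero, smul_zero]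
  exact eq_zero_of_zsmul_eq_zero (mul_ne_zero hd hb) key

/-- **Rank-one agreement, `R`-valued.** Two biadditive `R`-valued forms on an abelian group of
`ℤ`-rank one that agree at `(g, g)` for one non-torsion `g` are equal. [folklore] -/
theorem biadditive_eq_of_finrank_eq_one (B B' : A →+ A →+ R) (h : Module.finrank ℤ A = 1)
    {g : A} (hg : ¬ IsOfFinAddOrder g) (hgg : B g g = B' g g) : B = B' := by
  have hzero : ∀ Q Q', (B - B') Q Q' = 0 :=
    biadditive_apply_eq_zero_of_finrank_eq_one (B - B') h hg
      (by rw [AddMonoidHom.sub_apply, AddMonoidHom.sub_apply, hgg, sub_self])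
  refine AddMonoidHom.ext fun Q ↦ AddMonoidHom.ext fun Q' ↦ ?_
  have := hzero Q Q'
  rwa [AddMonoidHom.sub_apply, AddMonoidHom.sub_apply, sub_eq_zero] at this

end General

/-! ### §2 Rigidity of line-height data on a rank-one curve -/

section Rigidity

variable {W : WeierstrassCurve ℚ} {R : Type*} [CommRing R] [Algebra ℚ_[3] R]

/-- A line-height datum is determined by its pairings (the other four fields are propositions).
[cite: Benois2020, §0.3 (Definition p0004:L90)] -/
theorem eq_of_pairing_eq {Dh Dh' : W.PSLineHeightData R} (h : Dh.pairing = Dh'.pairing) :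
    Dh = Dh' := by
  obtain ⟨p, _, _, _, _⟩ := Dh
  obtain ⟨p', _, _, _, _⟩ := Dh'
  simp only at h
  subst h
  rfl

/-- **Rigidity.** On a curve with `rank_ℤ E(ℚ) = 1`, two line-height data that agree at `(g, g)` on
every LINE `χ` (`χ³ = 1`, `χ ≠ 1`), for one non-torsion point `g`, are equal: on a line the two
pairings are biadditive `R`-valued forms on the rank-one group `E(ℚ)` agreeing at `(g,g)` (§1, with
`rank_ℤ E(ℚ) = W.mordellWeilRank`, tree `finrank_point_eq_mordellWeilRank`); off the lines both vanish.
[cite: Benois2020, §0.3 (Thm. I–III)] [cite: Schneider1982PadicHeightI, §1] -/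
theorem eq_of_rank_one_of_forall_isLine (hr1 : W.mordellWeilRank = 1) (Dh Dh' : W.PSLineHeightData R)
    {g : W.toAffine.Point} (hg : ¬ IsOfFinAddOrder g)
    (h : ∀ χ : DirichletCharacter R 9, χ ^ 3 = 1 → χ ≠ 1 → Dh.pairing χ g g = Dh'.pairing χ g g) :
    Dh = Dh' := by
  have hfin : Module.finrank ℤ W.toAffine.Point = 1 := (finrank_point_eq_mordellWeilRank W).trans hr1
  refine eq_of_pairing_eq (funext fun χ ↦ ?_)
  by_cases hχ : χ ^ 3 = 1 ∧ χ ≠ 1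
  · exact biadditive_eq_of_finrank_eq_one _ _ hfin hg (h χ hχ.1 hχ.2)
  · rw [Dh.eq_zero_of_not_isLine χ hχ, Dh'.eq_zero_of_not_isLine χ hχ]

/-- Agreement of self-pairings transports along coefficient automorphisms: `h_{σχ}(g,g) = σ h_χ(g,g)`
for both data, and `σ` is injective. [cite: Benois2020, §0.3 (Definition p0004:L90)] -/
theorem pairing_ringHomComp_self_eq_iff (Dh Dh' : W.PSLineHeightData R) (σ : R ≃ₐ[ℚ_[3]] R)
    (χ : DirichletCharacter R 9) (g : W.toAffine.Point) :
    Dh.pairing (χ.ringHomComp (σ : R →+* R)) g g = Dh'.pairing (χ.ringHomComp (σ : R →+* R)) g g ↔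
      Dh.pairing χ g g = Dh'.pairing χ g g := by
  rw [Dh.conj, Dh'.conj, σ.injective.eq_iff]

/-- **Rigidity from ONE line.** If every line is `Aut(R/ℚ₃)`-conjugate to `ψ` (for the intended
`R = ℚ₃(ζ₃)` the lines are `ψ` and `ψ̄ = σ ∘ ψ`), then on a rank-one curve two data agreeing at
`(g, g)` on `ψ` alone, `g` non-torsion, are equal. [cite: Benois2020, §0.3 (Thm. I–III)] -/
theorem eq_of_rank_one_of_line_orbit (hr1 : W.mordellWeilRank = 1) (Dh Dh' : W.PSLineHeightData R)
    {g : W.toAffine.Point} (hg : ¬ IsOfFinAddOrder g) (ψ : DirichletCharacter R 9)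
    (horbit : ∀ χ : DirichletCharacter R 9, χ ^ 3 = 1 → χ ≠ 1 →
      ∃ σ : R ≃ₐ[ℚ_[3]] R, χ = ψ.ringHomComp (σ : R →+* R))
    (h : Dh.pairing ψ g g = Dh'.pairing ψ g g) : Dh = Dh' := by
  refine eq_of_rank_one_of_forall_isLine hr1 Dh Dh' hg fun χ h3 h1 ↦ ?_
  obtain ⟨σ, rfl⟩ := horbit χ h3 h1
  exact (pairing_ringHomComp_self_eq_iff Dh Dh' σ ψ g).mpr h

/-- **One number per `(W, ψ)`.** Under the same orbit hypothesis, on a rank-one curve the map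
`Dh ↦ h_ψ(g, g)` (one non-torsion `g`) is INJECTIVE on line-height data: a canonicity predicate (D5)
pins the whole datum as soon as it pins this single element of `R`. [cite: Benois2020, §0.3 (Thm. I–III)] -/
theorem pairing_self_injective_of_line_orbit (hr1 : W.mordellWeilRank = 1) {g : W.toAffine.Point}
    (hg : ¬ IsOfFinAddOrder g) (ψ : DirichletCharacter R 9)
    (horbit : ∀ χ : DirichletCharacter R 9, χ ^ 3 = 1 → χ ≠ 1 →
      ∃ σ : R ≃ₐ[ℚ_[3]] R, χ = ψ.ringHomComp (σ : R →+* R)) :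
    Function.Injective fun Dh : W.PSLineHeightData R ↦ Dh.pairing ψ g g :=
  fun Dh Dh' h ↦ eq_of_rank_one_of_line_orbit hr1 Dh Dh' hg ψ horbit h

/-- **The pairing at any two points from the one number** (rank one): if `b • Q = a • g` and
`d • Q' = c • g` then `(b d) • h_χ(Q, Q') = (a c) • h_χ(g, g)` — every value of the datum is a rational
multiple of `h_χ(g,g)` (the integer `b d ≠ 0` being invertible in `R`). [cite: Benois2020, §0.3 (Thm. I)] -/
theorem zsmul_pairing_eq_zsmul_pairing_self (Dh : W.PSLineHeightData R) (χ : DirichletCharacter R 9)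
    {g Q Q' : W.toAffine.Point} {a b c d : ℤ} (hQ : b • Q = a • g) (hQ' : d • Q' = c • g) :
    (b * d) • Dh.pairing χ Q Q' = (a * c) • Dh.pairing χ g g := by
  have h1 : Dh.pairing χ (b • Q) (d • Q') = b • d • Dh.pairing χ Q Q' := by
    rw [map_zsmul (Dh.pairing χ), AddMonoidHom.zsmul_apply, map_zsmul]
  have h2 : Dh.pairing χ (a • g) (c • g) = a • c • Dh.pairing χ g g := by
    rw [map_zsmul (Dh.pairing χ), AddMonoidHom.zsmul_apply, map_zsmul]
  rw [mul_smul, mul_smul, ← h1, ← h2, hQ, hQ']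

end Rigidity

/-! ### §3 Against the separated closer's `Can` slot: a canonicity predicate must pin the value -/

section CanMustPin

variable {W : WeierstrassCurve ℚ} {R : Type*} [CommRing R] [Algebra ℚ_[3] R]

/-- **`Can` must pin `h_ψ(P,P)`.** In the separated closer (cycu-p3, `psRankOne_halves_of_separated`)
GZ₃ reads «for every datum `Dh` with `Can Dh`, `c₁ = κ_an · q · ι(h_ψ(P,P))`». If the canonicity
predicate `Can` admits two data with DIFFERENT `ψ`-self-pairings at `P` (as every property shared by
all data does — junk data with any `ℚ₃`-value exist), then that hypothesis forces `κ_an · q = 0` — i.e. it is inconsistent with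
`κ_an ≠ 0` (MATCH) and `q ≠ 0` (rank one). So D5's `IsCanonicalFor` is usable in the closer exactly
when it determines the one number of §2. (`ι` injective, as in the closer.) [cite: Benois2020, §0.3 (Thm. II–III)] -/
theorem mul_eq_zero_of_gz3_forall_can_of_two_values (Can : W.PSLineHeightData R → Prop)
    {c₁ κ q : ℂ_[3]} {ι : R →ₐ[ℚ_[3]] ℂ_[3]} (hι : Function.Injective ι) {ψ : DirichletCharacter R 9}
    {P : W.toAffine.Point}
    (hGZ : ∀ Dh : W.PSLineHeightData R, Can Dh → c₁ = κ * q * ι (Dh.pairing ψ P P))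
    (htwo : ∃ Dh Dh' : W.PSLineHeightData R,
      Can Dh ∧ Can Dh' ∧ Dh.pairing ψ P P ≠ Dh'.pairing ψ P P) :
    κ * q = 0 := by
  obtain ⟨Dh, Dh', hC, hC', hne⟩ := htwo
  have h := (hGZ Dh hC).symm.trans (hGZ Dh' hC')
  have hne' : ι (Dh.pairing ψ P P) ≠ ι (Dh'.pairing ψ P P) := fun e ↦ hne (hι e)
  by_contra hκq
  exact hne' (mul_left_cancel₀ hκq h)

/-- **Conversely, a value-pinning `Can` is harmless for rigidity**: if `Can` determines `h_ψ(g,g)` at one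
non-torsion `g` (`∀ Dh Dh', Can Dh → Can Dh' → h_ψ(g,g) = h'_ψ(g,g)`) and every line is conjugate to
`ψ`, then on a rank-one curve `Can` has AT MOST ONE datum (§2) — the uniqueness lemma D5 asks for,
reduced to pinning one element of `R`. [cite: Benois2020, §0.3 (Thm. I–III)] -/
theorem can_subsingleton_of_pins_value (hr1 : W.mordellWeilRank = 1) (Can : W.PSLineHeightData R → Prop)
    {g : W.toAffine.Point} (hg : ¬ IsOfFinAddOrder g) (ψ : DirichletCharacter R 9)
    (horbit : ∀ χ : DirichletCharacter R 9, χ ^ 3 = 1 → χ ≠ 1 →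
      ∃ σ : R ≃ₐ[ℚ_[3]] R, χ = ψ.ringHomComp (σ : R →+* R))
    (hpin : ∀ Dh Dh' : W.PSLineHeightData R, Can Dh → Can Dh' → Dh.pairing ψ g g = Dh'.pairing ψ g g)
    {Dh Dh' : W.PSLineHeightData R} (hC : Can Dh) (hC' : Can Dh') : Dh = Dh' :=
  eq_of_rank_one_of_line_orbit hr1 Dh Dh' hg ψ horbit (hpin Dh Dh' hC hC')

end CanMustPin

end Summit.BirchSwinnertonDyer.BirchSwinnertonDyer.Theorems.CyclotomicUntwistLineHeightRigidity

end
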